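import Summits.CriticalPhenomena.SAWScalingLimit.Theorems.SAWCircleScreeningScreeningRecursionGeomB
import HarnessLib

/-!
# Screening recursion for `SAWCircleScreening`, part V: escaping to the core of the domain

Route `SAWCircleScreening` of `CriticalPhenomena/SAWScalingLimit`, support item
`ScreeningRecursion` (stmt-CriticalPhenomena-5468). Continuation of parts III–IV. With `Ω` flat
at `c` up to radius `ρ₀`, near data `K ⊆ B̄(c, r)`, `r ≤ 2ρ_t`, and a *core depth* `ε`:

* `escape_to_core` — a lattice point of `Ω` at distance in `(r, 3ρ_t + δ)` from `c` is joined,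
  in the mesh graph of `Ω ∖ K`, to a lattice point at distance `≥ ε` from `Ωᶜ` (ray away from
  `c` up to radius `3ρ_t`, then the ray of steepest ascent for `⌈2ε/δ⌉` steps: by the escape
  estimate it never comes back within `3ρ_t/√2 > r` of `c`);
* `reach_core_of_walk` — hence every lattice point at distance `> r` from `c` that is joined in
  the mesh graph of `Ω` to a core point is joined to a core point in the mesh graph of `Ω ∖ K`;
* `core_reachable_diff` — the core itself (lattice points of the bulk neighbourhood `V` of the
  tree's `exists_isOpen_isPreconnected_bulk`) stays connected in the mesh graph of `Ω ∖ K`.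

All folklore. Tree anchors: `meshVertexGraph_reachable_of_mem_bulk` (MeshDomainBulk),
`Metric.infDist_lt_iff`, `ball_infDist_compl_subset`.
-/

noncomputable section

open Set Metric Complex
open scoped ComplexConjugate
open Literature.Probability.LatticeModels

namespace Summit.CriticalPhenomena.SAWScalingLimit.Theorems.ScreeningRecursion

/-! ## Small real-analysis helpers -/

/-- From a lower bound on a square to a lower bound: `a² < ‖x‖²` gives `a < ‖x‖`.
[folklore] -/
theorem lt_norm_of_sq_lt {a : ℝ} {x : ℂ} (h : a ^ 2 < ‖x‖ ^ 2) : a < ‖x‖ := by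
  by_contra hle
  push Not at hle
  have := pow_le_pow_left₀ (norm_nonneg x) hle 2
  linarith

/-- `a² ≤ ‖x‖²` gives `a ≤ ‖x‖`. [folklore] -/
theorem le_norm_of_sq_le {a : ℝ} {x : ℂ} (h : a ^ 2 ≤ ‖x‖ ^ 2) : a ≤ ‖x‖ := by
  by_contra hlt
  push Not at hlt
  have := pow_lt_pow_left₀ hlt (norm_nonneg x) two_ne_zero
  linarith

/-- A lower bound for `infDist` from pointwise lower bounds (nonempty set). [folklore] -/
theorem le_infDist_of_forall {x : ℂ} {s : Set ℂ} (hs : s.Nonempty) {ε : ℝ}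
    (h : ∀ y ∈ s, ε ≤ dist x y) : ε ≤ infDist x s := by
  by_contra hlt
  push Not at hlt
  obtain ⟨y, hy, hxy⟩ := (infDist_lt_iff hs).1 hlt
  exact (not_le.2 hxy) (h y hy)

/-! ## Core points -/

/-- **Core criterion.** With `Ω` flat at `c` up to radius `ρ₀` and `u ≠ 0`: a point at
distance `≤ ρ₀ - ε` from `c` and of height `≥ 2 ε max(|Re u|, |Im u|)` is at distance `≥ ε`
from `Ωᶜ` (points of `Ωᶜ` in the flat ball have nonpositive height and the height is
`‖u‖`-Lipschitz with `‖u‖ ≤ √2 max(|Re u|, |Im u|)`; points outside the ball are `ε`-far).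
[folklore] -/
theorem le_infDist_compl_of_height {Ω : Set ℂ} {c u : ℂ} {ρ₀ ε : ℝ}
    (hflat : Ω ∩ ball c ρ₀ = {z | 0 < ((z - c) * u).im} ∩ ball c ρ₀) (hu : u ≠ 0)
    (hne : Ωᶜ.Nonempty) (hε : 0 < ε) {q : ℂ} (hq : dist q c ≤ ρ₀ - ε)
    (hh : 2 * ε * max |u.re| |u.im| ≤ ((q - c) * u).im) : ε ≤ infDist q Ωᶜ := by
  refine le_infDist_of_forall hne fun y hy => ?_
  by_cases hyc : ρ₀ ≤ dist y c
  · have := dist_triangle y q c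
    rw [dist_comm y q] at this
    linarith
  · push Not at hyc
    have hyh : ¬ 0 < ((y - c) * u).im := fun h => hy ((mem_iff_of_flat hflat (mem_ball.2 hyc)).2 h)
    push Not at hyh
    set us := max |u.re| |u.im| with hus
    have hus0 : 0 < us := rate_pos hu
    have hlip := abs_hgt_sub_hgt_le c u q y
    have h1 : 2 * ε * us ≤ ‖q - y‖ * ‖u‖ := by
      have := le_abs_self (((q - c) * u).im - ((y - c) * u).im)
      linarith
    have hnu : 0 < ‖u‖ := norm_pos_iff.2 hu
    by_contra hlt
    push Not at hlt
    rw [dist_eq_norm] at hlt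
    have h2 : ‖q - y‖ * ‖u‖ < ε * ‖u‖ := mul_lt_mul_of_pos_right hlt hnu
    have h3 : 2 * us < ‖u‖ := by nlinarith
    have h4 := sq_norm_le_two_mul_sq_rate u
    nlinarith

/-! ## Escaping to the core -/

/-- **Escape to the core.** `Ω` flat at `c` up to `ρ₀`, `u ≠ 0`, `Ωᶜ ≠ ∅`; near data
`K ⊆ B̄(c, r)` with `0 ≤ r ≤ 2ρ_t`; mesh `0 < δ ≤ ρ_t`; core depth `ε > 0`; room
`6ρ_t + 3δ + 3ε ≤ ρ₀`. Then a lattice point of `Ω` at distance in `(r, 3ρ_t + δ)` from `c` is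
joined in the mesh graph of `Ω ∖ K` on mesh vertices to a lattice point at distance `≥ ε` from
`Ωᶜ` (and `< ρ₀` from `c`). [folklore] -/
theorem escape_to_core {Ω K : Set ℂ} {c u : ℂ} {ρ₀ r ρt ε δ : ℝ}
    (hflat : Ω ∩ ball c ρ₀ = {z | 0 < ((z - c) * u).im} ∩ ball c ρ₀) (hu : u ≠ 0)
    (hne : Ωᶜ.Nonempty) (hK : K ⊆ closedBall c r) (hr0 : 0 ≤ r) (hrρ : r ≤ 2 * ρt)
    (hδ : 0 < δ) (hδρ : δ ≤ ρt) (hε : 0 < ε) (hgeom : 6 * ρt + 3 * δ + 3 * ε ≤ ρ₀)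
    {a : Site 2} (haΩ : meshPoint δ a ∈ Ω) (hfar : r < dist (meshPoint δ a) c)
    (hnear : dist (meshPoint δ a) c < 3 * ρt + δ) :
    ∃ z : Site 2, ε ≤ infDist (meshPoint δ z) Ωᶜ ∧ dist (meshPoint δ z) c < ρ₀ ∧
      ∃ (ha : a ∈ meshVertices (Ω \ K) δ) (hz : z ∈ meshVertices (Ω \ K) δ),
        (meshVertexGraph (Ω \ K) δ).Reachable ⟨a, ha⟩ ⟨z, hz⟩ := by
  have hρt : 0 < ρt := lt_of_lt_of_le hδ hδρ
  set p := meshPoint δ a with hp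
  have hpball : p ∈ ball c ρ₀ := mem_ball.2 (by linarith)
  have hh : 0 < ((p - c) * u).im := (mem_iff_of_flat hflat hpball).1 haΩ
  -- Phase 1: a good direction, and the first exit time of `B(c, 3ρ_t)`
  obtain ⟨i, s, hs, hrate, hdir⟩ := exists_good_step hh
  set e := Site.toComplex (Pi.single i s) with he_def
  have he : ‖e‖ = 1 := norm_toComplex_single i hs
  have hlow : ∀ t : ℝ, 0 ≤ t → ‖p - c‖ ^ 2 + t ^ 2 ≤ ‖p + (t : ℂ) * e - c‖ ^ 2 := by
    intro t ht
    have := sq_norm_add_real_mul_ge (p - c) e he ht hdir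
    rwa [show p - c + (t : ℂ) * e = p + (t : ℂ) * e - c by ring] at this
  have hexists : ∃ k : ℕ, 3 * ρt ≤ dist (p + ((δ * k : ℝ) : ℂ) * e) c := by
    obtain ⟨k, hk⟩ := exists_nat_ge (3 * ρt / δ)
    refine ⟨k, ?_⟩
    rw [dist_eq_norm]
    refine le_norm_of_sq_le ?_
    have h1 : 3 * ρt ≤ δ * k := by rw [div_le_iff₀ hδ] at hk; linarith
    have h2 := hlow (δ * k) (by positivity)
    nlinarith [norm_nonneg (p - c)]
  classical
  set n₁ := Nat.find hexists with hn₁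
  have hn₁spec : 3 * ρt ≤ dist (p + ((δ * n₁ : ℝ) : ℂ) * e) c := Nat.find_spec hexists
  have hn₁min : ∀ k : ℕ, k < n₁ → dist (p + ((δ * k : ℝ) : ℂ) * e) c < 3 * ρt := fun k hk => by
    have := Nat.find_min hexists hk
    push Not at this
    exact this
  -- the exit time is at most `3ρ_t + δ` in real time, and the exit radius `< 3ρ_t + δ`
  have hT : δ * n₁ < 3 * ρt + δ ∧ dist (p + ((δ * n₁ : ℝ) : ℂ) * e) c < 3 * ρt + δ := by
    rcases Nat.eq_zero_or_pos n₁ with h0 | hpos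
    · rw [h0]; simp only [Nat.cast_zero, mul_zero, Complex.ofReal_zero, zero_mul, add_zero]
      exact ⟨by linarith, hnear⟩
    · obtain ⟨m, hm⟩ : ∃ m, n₁ = m + 1 := ⟨n₁ - 1, by omega⟩
      have hmlt : m < n₁ := by omega
      have hm1 := hn₁min m hmlt
      -- the radius at time `δ m` is at least `δ m`
      have hm2 : δ * m ≤ dist (p + ((δ * m : ℝ) : ℂ) * e) c := by
        rw [dist_eq_norm]
        refine le_norm_of_sq_le ?_
        have := hlow (δ * m) (by positivity)
        nlinarith [norm_nonneg (p - c)]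
      constructor
      · rw [hm]; push_cast; nlinarith
      · -- consecutive ray points are at distance `δ`
        have hstep : dist (p + ((δ * n₁ : ℝ) : ℂ) * e) (p + ((δ * m : ℝ) : ℂ) * e) = δ := by
          rw [dist_eq_norm, hm]
          push_cast
          rw [show p + (δ : ℂ) * ((m : ℂ) + 1) * e - (p + (δ : ℂ) * (m : ℂ) * e) = (δ : ℂ) * e by ring,
            norm_mul, he, mul_one, Complex.norm_real, Real.norm_eq_abs, abs_of_pos hδ]
        have := dist_triangle (p + ((δ * n₁ : ℝ) : ℂ) * e) (p + ((δ * m : ℝ) : ℂ) * e) c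
        linarith
  -- Phase 1 ray
  have hray1 := ray_mem_and_reachable hflat hK hδ a i hs hh hrate.le n₁
    (fun t ht0 _ => by
      rw [dist_eq_norm]
      refine lt_norm_of_sq_lt ?_
      have h1 := hlow t ht0
      have h2 : r < ‖p - c‖ := by rwa [dist_eq_norm] at hfar
      nlinarith)
    (fun t ht0 ht1 => by
      calc dist (p + (t : ℂ) * e) c ≤ dist (p + (t : ℂ) * e) p + dist p c := dist_triangle _ _ _
        _ = t + dist p c := by
            rw [dist_eq_norm, add_sub_cancel_left, norm_mul, he, mul_one, Complex.norm_real,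
              Real.norm_eq_abs, abs_of_nonneg ht0]
        _ < (3 * ρt + δ) + (3 * ρt + δ) := add_lt_add (ht1.trans_lt hT.1) hnear
        _ ≤ ρ₀ := by linarith)
  obtain ⟨hmem1, hreach1⟩ := hray1
  set a₁ : Site 2 := a + Pi.single i ((n₁ : ℤ) * s) with ha₁
  obtain ⟨ha, ha₁v, hr₁⟩ := hreach1 a₁ rfl
  set p₁ := meshPoint δ a₁ with hp₁
  have hp₁eq : p₁ = p + ((δ * n₁ : ℝ) : ℂ) * e := meshPoint_ray δ a i s n₁
  have hp₁Ω : p₁ ∈ Ω := (hmem1 n₁ le_rfl).1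
  have hp₁far : 3 * ρt ≤ dist p₁ c := by rw [hp₁eq]; exact hn₁spec
  have hp₁near : dist p₁ c < 3 * ρt + δ := by rw [hp₁eq]; exact hT.2
  have hh₁ : 0 < ((p₁ - c) * u).im :=
    (mem_iff_of_flat hflat (mem_ball.2 (by linarith))).1 hp₁Ω
  -- Phase 2: steepest ascent for `n₂ = ⌈2ε/δ⌉` steps
  obtain ⟨i', s', hs', hrate', htrans'⟩ := exists_best_step u
  set e' := Site.toComplex (Pi.single i' s') with he'_def
  have he' : ‖e'‖ = 1 := norm_toComplex_single i' hs'
  set us := max |u.re| |u.im| with hus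
  have hus0 : 0 < us := rate_pos hu
  obtain ⟨n₂, hn₂⟩ : ∃ n₂ : ℕ, 2 * ε ≤ δ * n₂ ∧ δ * n₂ < 2 * ε + δ := by
    refine ⟨⌈2 * ε / δ⌉₊, ?_, ?_⟩
    · have := Nat.le_ceil (2 * ε / δ)
      rw [div_le_iff₀ hδ] at this; linarith
    · have h1 := Nat.ceil_lt_add_one (show 0 ≤ 2 * ε / δ by positivity)
      have h2 : (⌈2 * ε / δ⌉₊ : ℝ) * δ < (2 * ε / δ + 1) * δ := mul_lt_mul_of_pos_right h1 hδ
      rw [add_mul, div_mul_cancel₀ _ hδ.ne'] at h2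
      linarith
  have hlow2 : ∀ t : ℝ, 0 ≤ t → ‖p₁ - c‖ ^ 2 / 2 ≤ ‖p₁ + (t : ℂ) * e' - c‖ ^ 2 :=
    fun t ht => sq_norm_add_ge_half he' hus0 hrate' htrans' hh₁ ht
  have hray2 := ray_mem_and_reachable hflat hK hδ a₁ i' hs' hh₁ (by rw [hrate']; exact hus0.le) n₂
    (fun t ht0 _ => by
      rw [dist_eq_norm]
      refine lt_norm_of_sq_lt ?_
      have h1 := hlow2 t ht0
      have h2 : 3 * ρt ≤ ‖p₁ - c‖ := by rwa [dist_eq_norm] at hp₁far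
      have h3 : (3 * ρt) ^ 2 ≤ ‖p₁ - c‖ ^ 2 := pow_le_pow_left₀ (by positivity) h2 2
      nlinarith)
    (fun t ht0 ht1 => by
      calc dist (p₁ + (t : ℂ) * e') c ≤ dist (p₁ + (t : ℂ) * e') p₁ + dist p₁ c := dist_triangle _ _ _
        _ = t + dist p₁ c := by
            rw [dist_eq_norm, add_sub_cancel_left, norm_mul, he', mul_one, Complex.norm_real,
              Real.norm_eq_abs, abs_of_nonneg ht0]
        _ < (2 * ε + δ) + (3 * ρt + δ) := add_lt_add (ht1.trans_lt hn₂.2) hp₁near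
        _ ≤ ρ₀ := by linarith)
  obtain ⟨hmem2, hreach2⟩ := hray2
  set z : Site 2 := a₁ + Pi.single i' ((n₂ : ℤ) * s') with hz_def
  obtain ⟨ha₁v', hzv, hr₂⟩ := hreach2 z rfl
  have hzeq : meshPoint δ z = p₁ + ((δ * n₂ : ℝ) : ℂ) * e' := meshPoint_ray δ a₁ i' s' n₂
  -- the endpoint is a core point
  have hzdist : dist (meshPoint δ z) c ≤ ρ₀ - ε := by
    rw [hzeq]
    calc dist (p₁ + ((δ * n₂ : ℝ) : ℂ) * e') c
        ≤ dist (p₁ + ((δ * n₂ : ℝ) : ℂ) * e') p₁ + dist p₁ c := dist_triangle _ _ _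
      _ = δ * n₂ + dist p₁ c := by
          rw [dist_eq_norm, add_sub_cancel_left, norm_mul, he', mul_one, Complex.norm_real,
            Real.norm_eq_abs, abs_of_nonneg (by positivity)]
      _ ≤ (2 * ε + δ) + (3 * ρt + δ) := by linarith [hn₂.2]
      _ ≤ ρ₀ - ε := by linarith
  have hzh : 2 * ε * us ≤ ((meshPoint δ z - c) * u).im := by
    rw [hzeq, hgt_add_real_mul, hrate']
    nlinarith [hn₂.1]
  refine ⟨z, le_infDist_compl_of_height hflat hu hne hε hzdist hzh, by linarith, ha, hzv,
    hr₁.trans hr₂⟩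

/-! ## From a far point joined to the core, reach the core avoiding the near data -/

/-- **Reaching the core avoiding the near data.** Under the hypotheses of `escape_to_core` and
`2ρ_t < ε`: if a lattice point at distance `> r` from `c` is joined in the mesh graph of `Ω` on
mesh vertices to a lattice point at distance `≥ ε` from `Ωᶜ`, then it is joined to such a point
in the mesh graph of `Ω ∖ K`. (Induction along the walk: while the walk stays at distance
`≥ 3ρ_t + δ` from `c` its edges survive; at the first closer vertex, escape.) [folklore] -/
theorem reach_core_of_walk {Ω K : Set ℂ} {c u : ℂ} {ρ₀ r ρt ε δ : ℝ}
    (hflat : Ω ∩ ball c ρ₀ = {z | 0 < ((z - c) * u).im} ∩ ball c ρ₀) (hu : u ≠ 0)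
    (hne : Ωᶜ.Nonempty) (hK : K ⊆ closedBall c r) (hr0 : 0 ≤ r) (hrρ : r ≤ 2 * ρt)
    (hδ : 0 < δ) (hδρ : δ ≤ ρt) (hε : 0 < ε) (hgeom : 6 * ρt + 3 * δ + 3 * ε ≤ ρ₀)
    (hρtε : 2 * ρt < ε) {x y : meshVertices Ω δ} (π : (meshVertexGraph Ω δ).Walk x y)
    (hy : ε ≤ infDist (meshPoint δ y.1) Ωᶜ) (hx : r < dist (meshPoint δ x.1) c) :
    ∃ z : Site 2, ε ≤ infDist (meshPoint δ z) Ωᶜ ∧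
      ∃ (hx' : x.1 ∈ meshVertices (Ω \ K) δ) (hz : z ∈ meshVertices (Ω \ K) δ),
        (meshVertexGraph (Ω \ K) δ).Reachable ⟨x.1, hx'⟩ ⟨z, hz⟩ := by
  have hcΩ : c ∈ Ωᶜ := center_not_mem_of_flat hflat (by linarith)
  induction π with
  | nil =>
    rename_i v
    refine ⟨v.1, hy, mem_meshVertices_diff_of_far hK v.2 hx,
      mem_meshVertices_diff_of_far hK v.2 hx, SimpleGraph.Reachable.refl _⟩
  | cons hadj q ih =>
    rename_i v w t
    by_cases hvnear : dist (meshPoint δ v.1) c < 3 * ρt + δ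
    · obtain ⟨z, hz, -, hv', hzv, hr⟩ :=
        escape_to_core hflat hu hne hK hr0 hrρ hδ hδρ hε hgeom v.2 hx hvnear
      exact ⟨z, hz, hv', hzv, hr⟩
    · push Not at hvnear
      have hadj' : (meshGraph Ω δ).Adj v.1 w.1 := hadj
      rw [meshGraph_adj_iff] at hadj'
      have hvw : dist (meshPoint δ w.1) (meshPoint δ v.1) ≤ δ := by
        rw [dist_comm]; exact dist_meshPoint_le_of_adj hδ.le hadj'.1
      have hwfar : r < dist (meshPoint δ w.1) c := by
        have := dist_triangle (meshPoint δ v.1) (meshPoint δ w.1) c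
        rw [dist_comm (meshPoint δ v.1) (meshPoint δ w.1)] at this
        linarith
      obtain ⟨z, hz, hw', hzv, hr⟩ := ih hy hwfar
      have hv' : v.1 ∈ meshVertices (Ω \ K) δ := mem_meshVertices_diff_of_far hK v.2 hx
      refine ⟨z, hz, hv', hzv, SimpleGraph.Reachable.trans (SimpleGraph.Adj.reachable ?_) hr⟩
      change (meshGraph (Ω \ K) δ).Adj v.1 w.1
      refine meshGraph_adj_iff.2 ⟨hadj'.1, subset_closure_diff_of_far hK hadj'.2 fun o ho => ?_⟩
      have h1 : dist o (meshPoint δ v.1) ≤ δ := dist_le_of_mem_segment_of_adj hδ.le hadj'.1 ho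
      have h2 := dist_triangle (meshPoint δ v.1) o c
      rw [dist_comm (meshPoint δ v.1) o] at h2
      linarith

/-! ## The core stays connected -/

/-- **The core stays connected after removing the near data.** Let `V` be preconnected with
`ρ_V < infDist w Ωᶜ` for all `w ∈ V` (the bulk neighbourhood), `6δ ≤ ρ_V`, `c ∈ Ωᶜ` and near
data `K ⊆ B̄(c, r)` with `r < ρ_V / 2`. Then any two lattice points with mesh points in `V` are
joined in the mesh graph of `Ω ∖ K` on mesh vertices (through the union of the balls
`B(w, ρ_V/2)`, `w ∈ V`, which avoids `K`). [folklore] -/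
theorem core_reachable_diff {Ω K V : Set ℂ} {c : ℂ} {r ρV δ : ℝ} (hδ : 0 < δ) (hδρ : 6 * δ ≤ ρV)
    (hV : IsPreconnected V) (hVρ : ∀ w ∈ V, ρV < infDist w Ωᶜ) (hc : c ∈ Ωᶜ)
    (hK : K ⊆ closedBall c r) (hr : r < ρV / 2) {x y : Site 2}
    (hx : meshPoint δ x ∈ V) (hy : meshPoint δ y ∈ V) :
    ∃ (hx' : x ∈ meshVertices (Ω \ K) δ) (hy' : y ∈ meshVertices (Ω \ K) δ),
      (meshVertexGraph (Ω \ K) δ).Reachable ⟨x, hx'⟩ ⟨y, hy'⟩ := by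
  set Ω'' : Set ℂ := ⋃ w ∈ V, ball w (ρV / 2) with hΩ''
  have hballs : ∀ w ∈ V, ball w (ρV / 2) ⊆ Ω'' := fun w hw z hz => mem_biUnion hw hz
  obtain ⟨hx1, hy1, hr1⟩ :=
    meshVertexGraph_reachable_of_mem_bulk (Ω := Ω'') hδ (by linarith) hV hballs hx hy
  have hsub : Ω'' ⊆ Ω \ K := by
    intro z hz
    rw [hΩ'', mem_iUnion₂] at hz
    obtain ⟨w, hw, hzw⟩ := hz
    have hwρ := hVρ w hw
    constructor
    · have : z ∈ ball w (infDist w Ωᶜ) := ball_subset_ball (by linarith) hzw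
      exact ball_infDist_compl_subset this
    · intro hzK
      have h1 : dist z c ≤ r := mem_closedBall.1 (hK hzK)
      have h2 : dist w c < ρV := by
        have := dist_triangle w z c
        rw [dist_comm w z] at this
        linarith [mem_ball.1 hzw]
      have h3 : infDist w Ωᶜ ≤ dist w c := infDist_le_dist_of_mem hc
      linarith
  exact ⟨hsub hx1, hsub hy1, reachable_mono_domain hsub hx1 hy1 hr1⟩

end Summit.CriticalPhenomena.SAWScalingLimit.Theorems.ScreeningRecursion

end
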